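import Summits.ResolutionOfSingularities.ResolutionOfSingularities.Theorems.MarkedTransferCampaignW46ThreefoldsGammaFreeGlobalSmooth
import Summits.ResolutionOfSingularities.ResolutionOfSingularities.Theorems.MarkedTransferCampaignW46ThreefoldsGammaFreeGlobalSurfaces
import Summits.ResolutionOfSingularities.ResolutionOfSingularities.Theorems.MarkedTransferCampaignW46ThreefoldsGammaFreeGlobalLadderWitness
import Literature.AlgebraicGeometry.Hironaka2017.Lib.SpecOrders
import Literature.AlgebraicGeometry.Resolution.IdealSheafLemmas
import Literature.AlgebraicGeometry.Resolution.BlowupChartMembership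
import Literature.AlgebraicGeometry.Resolution.Hironaka2005FlatSmoothChart
import HarnessLib

/-!
# [OURS · L1 W4.6 rung (ii-C)] CYLINDERS OVER PLANE-CURVE SINGULARITIES ARE ORDER-REDUCIBLE — the first infinite NON-MONOMIAL
# family of inputs of the statement of record `GammaFreeGlobalOrderReductionDimLE p 3`, PROVED (rung `d = 2` ∘ smooth transfer)

Cell res-hironaka, LADDER-RESOLUTION rung L (D-0089), slot W4.6, rung (ii) (threefold hypersurfaces) in the DIMENSION LADDER of
the Γ-free global order-reduction statement (typer res-L1-type-o1: `…ThreefoldsGammaFreeGlobalLadder.lean` p496755,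
`OrderReducible I m`, `GammaFreeGlobalOrderReductionDimLE p d`). Seat res-L1-s46-pv-3 (gen 5). Host route MarkedTransfer, host
item `HypersurfaceOrderReductionDimLeThree` (stmt-ResolutionOfSingularities-16156); filed `--kind proof --supports` it `--as helper`.
Everything here is OURS: kernel theorems over the campaign definitions and PROVED campaign / tree lemmas; NOTHING is a statement
of Hironaka's manuscript; no typed `Hironaka2017` candidate enters; no named FACT is a hypothesis. AI-written; AI review is
weaker than expert review.

## What is proved (no definitions)

The corollary announced in `…ThreefoldsGammaFreeGlobalSmooth.lean` (p504308, §5 «with rung d = 2 it will settle every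
cylinder over a plane-curve singularity») now that rung `d = 2` is a kernel theorem (`gammaFreeGlobalDimLE_two`,
res-D-pv-049 AS res-L1-s46-pv-11, p514156):

* `orderReducible_of_smooth_over_surface` — **every SMOOTH PULL-BACK of a surface input is order-reducible, in any dimension**:
  for `p` prime, `k` perfect of characteristic `p`, `S` a separated quasi-compact integral regular `k`-scheme locally of finite
  type of dimension `≤ 2`, `I ≠ 0` effective Cartier on `S`, `φ : X′ ⟶ S` smooth and `m ≥ 1`: `OrderReducible (φ^* I) m`.
* `orderReducible_fst_of_surface` — the product form: `OrderReducible (pr₁^* I) m` on `S ×_k Y` for every smooth `Y → Spec k`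
  (threefolds `S ×_k C` over a smooth curve `C`, `S ×_k 𝔸ⁿ_k`, …).
* `shf_span_singleton_ne_bot`, `isEffectiveCartier_shf_span_singleton` — plumbing: on `Spec R`, `R` a domain, the ideal sheaf of
  a principal ideal `(f)`, `f ≠ 0`, is a non-zero effective Cartier ideal.
* `orderReducible_cylinder` — **CYLINDERS OVER AFFINE PLANE CURVES**: for every `0 ≠ f ∈ K[x, y]` (`K` perfect of characteristic
  `p`), every SMOOTH `K[x, y]`-algebra `B` and every `m ≥ 1`, the ideal sheaf `(f)·𝒪_{Spec B}` is order-reducible: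
  `OrderReducible ((f B)·𝒪) m`. Instances: `orderReducible_cylinder_polynomial` (`B = K[x, y][z]`: the cylinder
  `(f(x, y)) ⊂ K[x, y, z]` over the plane curve `f = 0` — cusps `y² − x³`, `y^p − xⁿ`, any reduced or non-reduced plane curve),
  `orderReducible_cylinder_mvPolynomial` (`B = K[x, y][z₁, …, z_n]`, any `n`).

HONEST VALUE. A COROLLARY (rung `d = 2` ∘ the smooth transfer principle), not a new rung: it banks, at `d = 3` and beyond, an
infinite family of NON-MONOMIAL inputs of the statement of record whose order-`m` loci are positive-dimensional (the singular
lines `Sing(f) × 𝔸¹`), complementing the monomial / order-one / isolated-`τ ≥ 2` / `τ ≥ 2`-curve slices of gens 3–4. It says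
nothing about inputs that are not smooth-locally pulled back from a surface (the generic threefold hypersurface).

References: `…ThreefoldsGammaFreeGlobalSmooth.lean` (p504308: `orderReducible_of_smooth_over_rung`, `OrderReducible.comap_of_smooth`),
`…ThreefoldsGammaFreeGlobalSurfaces.lean` (p514156: `gammaFreeGlobalDimLE_two`), `…ThreefoldsGammaFreeGlobalLadderWitness.lean`
(binders of affine space `LadderWitness.*_affineSpace`), tree `Resolution/IdealSheafLemmas.lean` (`comap_ofIdealTop_SpecMap`,
`mem_nonZeroDivisors_of_inverse`), `Resolution/BlowupChartMembership.lean` (`isEffectiveCartier_of_ideal_top_eq_span`),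
`Resolution/Hironaka2005FlatSmoothChart.lean` (`Hironaka2005.smooth_Spec_map_algebraMap` [GortzWedhorn2020, Lemma 6.26]),
`Hironaka2017/Lib/SpecOrders.lean` (plumbing `Zs`, `shf`, `toΓ` only — no manuscript content). Mathematics: [Hartshorne1977,
Ch. V Thm. 3.9] (the surface rung), [BierstoneGrigorievMilmanWlodarczyk2011, Thm. 8.0.5] (functoriality under smooth morphisms).
H. Hironaka, ms. 2017-03-23, Def. 2.4 p.6 — scope only, under adjudication, not cited as fact. [Hironaka2017]
-/

noncomputable section

set_option linter.dupNamespace false -- mandated namespace of this single-conjunct summit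

open CategoryTheory CategoryTheory.Limits AlgebraicGeometry TopologicalSpace

namespace Summit.ResolutionOfSingularities.ResolutionOfSingularities.Theorems

namespace CampaignW46

open Literature.AlgebraicGeometry.Resolution
open Literature.AlgebraicGeometry.Hironaka2017.SpecOrders
open Scheme.IdealSheafData

universe u

/-! ## §1 Smooth pull-backs of surface inputs -/

/-- **EVERY SMOOTH PULL-BACK OF A SURFACE INPUT IS ORDER-REDUCIBLE (any dimension).** For `p` prime, `k` perfect of
characteristic `p`, `S` a separated, locally-of-finite-type, quasi-compact, integral, regular `k`-scheme of dimension `≤ 2`,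
`I ≠ 0` an effective Cartier ideal on `S`, `φ : X′ ⟶ S` SMOOTH and `m ≥ 1`: `OrderReducible (φ^* I) m` — rung `d = 2`
(`gammaFreeGlobalDimLE_two`) through the transfer principle `orderReducible_of_smooth_over_rung`.
[cite: Hartshorne1977, Ch. V Thm. 3.9] [cite: BierstoneGrigorievMilmanWlodarczyk2011, Thm. 8.0.5] -/
theorem orderReducible_of_smooth_over_surface {p : ℕ} (hp : p.Prime) (k : Type u) [Field k] [CharP k p] [PerfectField k]
    (S : Scheme.{u}) (s : S ⟶ Spec (.of k)) (hsep : IsSeparated s) (hloft : LocallyOfFiniteType s) (hqc : QuasiCompact s)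
    (hint : IsIntegral S) (hreg : Scheme.IsRegular S) (hdim : topologicalKrullDim S ≤ 2) (I : S.IdealSheafData) (hI : I ≠ ⊥)
    (hIc : IsEffectiveCartier I) {X' : Scheme.{u}} (φ : X' ⟶ S) [Smooth φ] {m : ℕ} (hm : 1 ≤ m) :
    OrderReducible (I.comap φ) m :=
  orderReducible_of_smooth_over_rung (gammaFreeGlobalDimLE_two.{u} p) hp k S s hsep hloft hqc hint hreg
    (by exact_mod_cast hdim) I hI hIc φ hm

/-- **PRODUCT FORM**: for a surface input `(S, I)` as above and ANY smooth `t : Y ⟶ Spec k` (a smooth curve, `𝔸ⁿ_k`, …), the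
pull-back of `I` to `S ×_k Y` along the first projection is order-reducible for every `m ≥ 1` (the projection is smooth:
base change of `t`). [cite: BierstoneGrigorievMilmanWlodarczyk2011, Thm. 8.0.5] -/
theorem orderReducible_fst_of_surface {p : ℕ} (hp : p.Prime) (k : Type u) [Field k] [CharP k p] [PerfectField k]
    (S : Scheme.{u}) (s : S ⟶ Spec (.of k)) (hsep : IsSeparated s) (hloft : LocallyOfFiniteType s) (hqc : QuasiCompact s)
    (hint : IsIntegral S) (hreg : Scheme.IsRegular S) (hdim : topologicalKrullDim S ≤ 2) (I : S.IdealSheafData) (hI : I ≠ ⊥)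
    (hIc : IsEffectiveCartier I) {Y : Scheme.{u}} (t : Y ⟶ Spec (.of k)) [Smooth t] {m : ℕ} (hm : 1 ≤ m) :
    OrderReducible (I.comap (pullback.fst s t)) m :=
  haveI : Smooth (pullback.fst s t) := MorphismProperty.pullback_fst _ _ inferInstance
  orderReducible_of_smooth_over_surface hp k S s hsep hloft hqc hint hreg hdim I hI hIc _ hm

/-! ## §2 Plumbing: principal ideal sheaves on affine schemes -/

section Principal

variable (R : Type u) [CommRing R]

/-- `R → Γ(Spec R, ⊤)` is injective (it has the two-sided inverse `ofΓ`). [folklore] -/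
theorem toΓ_injective : Function.Injective (toΓ R) := fun a b h => by
  have := congrArg (ofΓ R) h
  rwa [ofΓ_toΓ, ofΓ_toΓ] at this

/-- On `Spec R`, the ideal sheaf `(f)·𝒪` of a principal ideal with `f ≠ 0` is not the zero ideal sheaf. [folklore] -/
theorem shf_span_singleton_ne_bot {f : R} (hf : f ≠ 0) : shf R (Ideal.span {f}) ≠ ⊥ := by
  intro h
  have h1 := shf_ideal_top R (Ideal.span {f})
  rw [h, Scheme.IdealSheafData.ideal_bot, Pi.bot_apply, eq_comm, Ideal.map_span, Set.image_singleton,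
    Ideal.span_singleton_eq_bot] at h1
  exact hf (toΓ_injective R (h1.trans (map_zero _).symm))

/-- On `Spec R`, `R` a domain, the ideal sheaf `(f)·𝒪` of a principal ideal with `f ≠ 0` is an effective Cartier ideal
(generated by a nonzerodivisor). [cite: GortzWedhorn2020, (13.19) p. 413 with Remark 11.27] -/
theorem isEffectiveCartier_shf_span_singleton [IsDomain R] {f : R} (hf : f ≠ 0) :
    IsEffectiveCartier (shf R (Ideal.span {f})) := by
  have hg : f ∈ nonZeroDivisors R := mem_nonZeroDivisors_of_ne_zero hf
  refine isEffectiveCartier_of_ideal_top_eq_span _ (g := toΓ R f) ?_ ?_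
  · exact mem_nonZeroDivisors_of_inverse (toΓ R) (ofΓ R) (ofΓ_toΓ R) (toΓ_ofΓ R) hg
  · rw [shf_ideal_top, Ideal.map_span, Set.image_singleton]

/-- The inverse image of `I·𝒪_{Spec A}` along `Spec g : Spec B → Spec A` is `(g I)·𝒪_{Spec B}` (tree `comap_ofIdealTop_SpecMap`
in the `shf` notation). [folklore] -/
theorem shf_comap_specMap {A B : Type u} [CommRing A] [CommRing B] (g : A →+* B) (I : Ideal A) :
    (shf A I).comap (Spec.map (CommRingCat.ofHom g)) = shf B (I.map g) :=
  comap_ofIdealTop_SpecMap g I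

end Principal

/-! ## §3 Cylinders over affine plane curves -/

section Cylinder

variable (K : Type u) [Field K] [PerfectField K]

/-- **CYLINDERS OVER AFFINE PLANE CURVES ARE ORDER-REDUCIBLE.** For `K` perfect of characteristic `p`, every
`0 ≠ f ∈ K[x, y]`, every SMOOTH `K[x, y]`-algebra `B` (`K[x, y][z]`, `K[x, y][z₁, …, z_n]`, localisations, étale extensions, …)
and every `m ≥ 1`: the principal ideal sheaf `(f)·𝒪_{Spec B}` is order-reducible, `OrderReducible ((f B)·𝒪) m` — the surface
input `(𝔸²_K, (f))` (binders: `LadderWitness.*_affineSpace`, §2) pulled back along the smooth `Spec B → 𝔸²_K` (§1; tree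
`Hironaka2005.smooth_Spec_map_algebraMap`).
[cite: Hartshorne1977, Ch. V Thm. 3.9] [cite: BierstoneGrigorievMilmanWlodarczyk2011, Thm. 8.0.5] -/
theorem orderReducible_cylinder (p : ℕ) [Fact p.Prime] [CharP K p] {f : MvPolynomial (Fin 2) K} (hf : f ≠ 0)
    (B : Type u) [CommRing B] [Algebra (MvPolynomial (Fin 2) K) B] [Algebra.Smooth (MvPolynomial (Fin 2) K) B] {m : ℕ}
    (hm : 1 ≤ m) : OrderReducible (shf B (Ideal.span {algebraMap (MvPolynomial (Fin 2) K) B f})) m := by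
  haveI := Hironaka2005.smooth_Spec_map_algebraMap (MvPolynomial (Fin 2) K) B
  have h := orderReducible_of_smooth_over_surface (p := p) Fact.out K (Zs (MvPolynomial (Fin 2) K))
    (Spec.map (CommRingCat.ofHom (algebraMap K (MvPolynomial (Fin 2) K)))) (LadderWitness.isSeparated_affineSpace K 2)
    (LadderWitness.locallyOfFiniteType_affineSpace K 2) (LadderWitness.quasiCompact_affineSpace K 2)
    (LadderWitness.isIntegral_affineSpace K 2) (LadderWitness.isRegular_affineSpace K 2)
    (LadderWitness.topologicalKrullDim_affineSpace_le K 2 le_rfl) (shf _ (Ideal.span {f}))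
    (shf_span_singleton_ne_bot _ hf) (isEffectiveCartier_shf_span_singleton _ hf)
    (Spec.map (CommRingCat.ofHom (algebraMap (MvPolynomial (Fin 2) K) B))) hm
  rwa [shf_comap_specMap, Ideal.map_span, Set.image_singleton] at h

/-- **THE CYLINDER `(f(x, y)) ⊂ K[x, y][z]` over the plane curve `f = 0`** (`f ≠ 0`; cusps `y² − x³`, `y^p − xⁿ`, nodes, non-reduced
curves, …) is order-reducible for every `m ≥ 1`, `K` perfect of characteristic `p`. [cite: Hartshorne1977, Ch. V Thm. 3.9] -/
theorem orderReducible_cylinder_polynomial (p : ℕ) [Fact p.Prime] [CharP K p] {f : MvPolynomial (Fin 2) K} (hf : f ≠ 0)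
    {m : ℕ} (hm : 1 ≤ m) : OrderReducible (shf (Polynomial (MvPolynomial (Fin 2) K)) (Ideal.span {Polynomial.C f})) m :=
  haveI : Algebra.Smooth (MvPolynomial (Fin 2) K) (Polynomial (MvPolynomial (Fin 2) K)) := {}
  orderReducible_cylinder K p hf (Polynomial (MvPolynomial (Fin 2) K)) hm

/-- **THE CYLINDERS `(f(x, y)) ⊂ K[x, y][z₁, …, z_n]`** (any `n`; at `n = 1` threefolds, inputs of the statement of record
`d = 3`) are order-reducible for every `m ≥ 1`, `K` perfect of characteristic `p`. [cite: Hartshorne1977, Ch. V Thm. 3.9] -/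
theorem orderReducible_cylinder_mvPolynomial (p : ℕ) [Fact p.Prime] [CharP K p] {f : MvPolynomial (Fin 2) K}
    (hf : f ≠ 0) (n : ℕ) {m : ℕ} (hm : 1 ≤ m) :
    OrderReducible (shf (MvPolynomial (Fin n) (MvPolynomial (Fin 2) K)) (Ideal.span {MvPolynomial.C f})) m :=
  haveI : Algebra.Smooth (MvPolynomial (Fin 2) K) (MvPolynomial (Fin n) (MvPolynomial (Fin 2) K)) := {}
  orderReducible_cylinder K p hf (MvPolynomial (Fin n) (MvPolynomial (Fin 2) K)) hm

end Cylinder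

end CampaignW46

end Summit.ResolutionOfSingularities.ResolutionOfSingularities.Theorems

end
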